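import Mathlib
import HarnessLib
import Literature.Analysis.FluidPDE.VorticityCalculus
import Literature.Analysis.FluidPDE.AxisymNoSwirlVorticity
import Literature.Analysis.FunctionSpaces.SmoothParametricIntegral
import Summits.NavierStokesRegularity.NavierStokesRegularity.Theorems.AxisTwistDoorAveragedConeLiouvilleDefs

/-!
# Route `AxisTwistDoor`, crux `AveragedConeLiouville` (stmt-NavierStokesRegularity-26889), line `lrt_shell`,
# stub (1) `stub_circleSwirl` — brick B1: STOKES ON CIRCLES, `∂ᵣ Γ = ∮ ω₃ dl`

For a `C¹` vector field `w` on `ℝ³` and the horizontal circle `S(r,z) = {(r cos θ, r sin θ, z)}` about the vertical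
axis, the axis circulation `r ↦ ∫₀^{2π} ⟪w(r cos θ, r sin θ, z), e_θ⟫ r dθ` is differentiable in `r` with derivative
`∫₀^{2π} ⟪curl w (r cos θ, r sin θ, z), e₃⟫ r dθ` (Stokes' theorem on the disc `D(r,z)`, in the differentiated form
that needs no measure theory on discs): pointwise `∂ᵣ(r w_θ) − ∂_θ w_r = r ω₃` in cylindrical components
(`hasDerivAt_integrand_r`, `hasDerivAt_radial_theta`, `key_identity`), the `θ`-derivative integrates to zero over the
period (`integral_theta_deriv_eq_zero`), and one derivative passes under the integral sign for the `C¹` integrand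
(`Literature.Analysis.FunctionSpaces.hasFDerivAt_parametric_intervalIntegral`).  In the vocabulary of
`AxisTwistDoorAveragedConeLiouvilleDefs`: `HasDerivAt (fun r' => circ v r' z s) (vortCirc v r z s) r` for every slice
`v s ∈ C¹` (`hasDerivAt_circ`, `deriv_circ_eq_vortCirc`) — the first conjunct of `CircleSwirlEquation`, for smooth slices.

WHAT THIS IS NOT: a calculus lemma about circle integrals of `C¹` fields; nothing about Navier–Stokes regularity
(Clay A) is proved or claimed, and no item is closed by this file (`--supports` stmt-…-26889 only).
-/

noncomputable section

-- the summit and its single sub-problem share the name (CONVENTIONS §1), as in every Theorems file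
set_option linter.dupNamespace false

namespace Summit.NavierStokesRegularity.NavierStokesRegularity.Theorems.AveragedConeLiouville.CircleStokes

open scoped Topology InnerProductSpace
open Set Function MeasureTheory intervalIntegral
open Literature.Analysis Literature.Analysis.FunctionSpaces
open Literature.Analysis.FluidPDE hiding eR
open Summit.NavierStokesRegularity.NavierStokesRegularity.Theorems.AxisTwistDoorAveragedConeLiouvilleDefs

/-! ### The cylindrical frame in terms of the standard basis -/

/-- `cylPt r θ z = r • e_r(θ) + z • e₃`. -/
theorem cylPt_eq_smul_eR (r θ z : ℝ) : cylPt r θ z = r • eR θ + z • e3 := by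
  ext i
  fin_cases i <;> simp [cylPt, eR, e3]

/-- `e_r(θ) = cos θ • e₀ + sin θ • e₁`. -/
theorem eR_eq (θ : ℝ) :
    eR θ = Real.cos θ • (EuclideanSpace.single (0 : Fin 3) (1 : ℝ))
      + Real.sin θ • (EuclideanSpace.single (1 : Fin 3) (1 : ℝ)) := by
  ext i
  fin_cases i <;> simp [eR]

/-- `e_θ(θ) = −sin θ • e₀ + cos θ • e₁`. -/
theorem eT_eq (θ : ℝ) :
    eT θ = -Real.sin θ • (EuclideanSpace.single (0 : Fin 3) (1 : ℝ))
      + Real.cos θ • (EuclideanSpace.single (1 : Fin 3) (1 : ℝ)) := by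
  ext i
  fin_cases i <;> simp [eT]

/-- `cylPt r θ z = cos θ • (r • e₀) + sin θ • (r • e₁) + z • e₃` (the form differentiated in `θ`). -/
theorem cylPt_eq_cos_sin (r θ z : ℝ) :
    cylPt r θ z = Real.cos θ • (r • (EuclideanSpace.single (0 : Fin 3) (1 : ℝ)))
      + Real.sin θ • (r • (EuclideanSpace.single (1 : Fin 3) (1 : ℝ))) + z • e3 := by
  ext i
  fin_cases i <;> simp [cylPt, e3] <;> ring

/-- `⟪u, e₃⟫ = u₂`. -/
theorem inner_e3 (u : EuclideanSpace ℝ (Fin 3)) : ⟪u, e3⟫_ℝ = u 2 := by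
  simp [e3, EuclideanSpace.inner_single_right]

/-- The frame is `2π`-periodic: `cylPt r (2π) z = cylPt r 0 z`. -/
theorem cylPt_two_pi (r z : ℝ) : cylPt r (2 * Real.pi) z = cylPt r 0 z := by
  simp [cylPt]

/-- The frame is `2π`-periodic: `e_r(2π) = e_r(0)`. -/
theorem eR_two_pi : eR (2 * Real.pi) = eR 0 := by
  simp [eR]

/-- `θ ↦ e_r(θ)` is continuous. -/
theorem continuous_eR : Continuous eR := by
  rw [show eR = fun θ => Real.cos θ • (EuclideanSpace.single (0 : Fin 3) (1 : ℝ))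
      + Real.sin θ • (EuclideanSpace.single (1 : Fin 3) (1 : ℝ)) from funext eR_eq]
  fun_prop

/-- `θ ↦ e_θ(θ)` is continuous. -/
theorem continuous_eT : Continuous eT := by
  rw [show eT = fun θ => -Real.sin θ • (EuclideanSpace.single (0 : Fin 3) (1 : ℝ))
      + Real.cos θ • (EuclideanSpace.single (1 : Fin 3) (1 : ℝ)) from funext eT_eq]
  fun_prop

/-- `(r, θ) ↦ cylPt r θ z` is smooth, as a function on `ℝ × ℝ` (variables `(θ, r)`). -/
theorem contDiff_cylPt (z : ℝ) {n : WithTop ℕ∞} :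
    ContDiff ℝ n (fun q : ℝ × ℝ => cylPt q.2 q.1 z) := by
  have h : (fun q : ℝ × ℝ => cylPt q.2 q.1 z) = fun q : ℝ × ℝ =>
      Real.cos q.1 • (q.2 • (EuclideanSpace.single (0 : Fin 3) (1 : ℝ)))
        + Real.sin q.1 • (q.2 • (EuclideanSpace.single (1 : Fin 3) (1 : ℝ))) + z • e3 :=
    funext fun q => cylPt_eq_cos_sin q.2 q.1 z
  rw [h]
  fun_prop

/-- `θ ↦ e_θ(θ)` is smooth. -/
theorem contDiff_eT {n : WithTop ℕ∞} : ContDiff ℝ n eT := by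
  rw [show eT = fun θ => -Real.sin θ • (EuclideanSpace.single (0 : Fin 3) (1 : ℝ))
      + Real.cos θ • (EuclideanSpace.single (1 : Fin 3) (1 : ℝ)) from funext eT_eq]
  fun_prop

/-! ### Derivatives of the frame -/

/-- `∂ᵣ cylPt = e_r`. -/
theorem hasDerivAt_cylPt_r (r θ z : ℝ) : HasDerivAt (fun r' => cylPt r' θ z) (eR θ) r := by
  rw [show (fun r' => cylPt r' θ z) = fun r' => r' • eR θ + z • e3 from
    funext fun r' => cylPt_eq_smul_eR r' θ z]
  simpa using ((hasDerivAt_id r).smul_const (eR θ)).add_const (z • e3)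

/-- `∂_θ cylPt = r • e_θ`. -/
theorem hasDerivAt_cylPt_theta (r θ z : ℝ) :
    HasDerivAt (fun θ' => cylPt r θ' z) (r • eT θ) θ := by
  rw [show (fun θ' => cylPt r θ' z) = fun θ' =>
      Real.cos θ' • (r • (EuclideanSpace.single (0 : Fin 3) (1 : ℝ)))
        + Real.sin θ' • (r • (EuclideanSpace.single (1 : Fin 3) (1 : ℝ))) + z • e3 from
    funext fun θ' => cylPt_eq_cos_sin r θ' z]
  have h := (((Real.hasDerivAt_cos θ).smul_const (r • (EuclideanSpace.single (0 : Fin 3) (1 : ℝ)))).add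
    ((Real.hasDerivAt_sin θ).smul_const (r • (EuclideanSpace.single (1 : Fin 3) (1 : ℝ))))).add_const (z • e3)
  refine h.congr_deriv ?_
  ext i
  fin_cases i <;> simp [eT] <;> ring

/-- `∂_θ e_r = e_θ`. -/
theorem hasDerivAt_eR (θ : ℝ) : HasDerivAt eR (eT θ) θ := by
  rw [show eR = fun θ => Real.cos θ • (EuclideanSpace.single (0 : Fin 3) (1 : ℝ))
      + Real.sin θ • (EuclideanSpace.single (1 : Fin 3) (1 : ℝ)) from funext eR_eq]
  have h := ((Real.hasDerivAt_cos θ).smul_const (EuclideanSpace.single (0 : Fin 3) (1 : ℝ))).add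
    ((Real.hasDerivAt_sin θ).smul_const (EuclideanSpace.single (1 : Fin 3) (1 : ℝ)))
  refine h.congr_deriv ?_
  ext i
  fin_cases i <;> simp [eT]

/-! ### The pointwise identity `∂ᵣ(r w_θ) − ∂_θ w_r = r ω₃` -/

variable {w : EuclideanSpace ℝ (Fin 3) → EuclideanSpace ℝ (Fin 3)}

/-- `∂ᵣ [⟪w(cylPt r θ z), e_θ⟫ r] = ⟪Dw(cylPt r θ z) e_r, e_θ⟫ r + ⟪w(cylPt r θ z), e_θ⟫`. -/
theorem hasDerivAt_integrand_r (hw : ContDiff ℝ 1 w) (r θ z : ℝ) :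
    HasDerivAt (fun r' => ⟪w (cylPt r' θ z), eT θ⟫_ℝ * r')
      (⟪fderiv ℝ w (cylPt r θ z) (eR θ), eT θ⟫_ℝ * r + ⟪w (cylPt r θ z), eT θ⟫_ℝ) r := by
  have h1 : HasDerivAt (fun r' => w (cylPt r' θ z)) (fderiv ℝ w (cylPt r θ z) (eR θ)) r :=
    ((hw.differentiable one_ne_zero) _).hasFDerivAt.comp_hasDerivAt r (hasDerivAt_cylPt_r r θ z)
  have h2 : HasDerivAt (fun r' => ⟪w (cylPt r' θ z), eT θ⟫_ℝ)
      (⟪fderiv ℝ w (cylPt r θ z) (eR θ), eT θ⟫_ℝ) r := by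
    simpa using h1.inner ℝ (hasDerivAt_const r (eT θ))
  have h3 : HasDerivAt (fun r' => ⟪w (cylPt r' θ z), eT θ⟫_ℝ * r')
      (⟪fderiv ℝ w (cylPt r θ z) (eR θ), eT θ⟫_ℝ * id r + ⟪w (cylPt r θ z), eT θ⟫_ℝ * 1) r :=
    h2.mul (hasDerivAt_id r)
  simpa using h3

/-- `∂_θ ⟪w(cylPt r θ z), e_r(θ)⟫ = ⟪w(cylPt r θ z), e_θ⟫ + ⟪Dw(cylPt r θ z) (r e_θ), e_r⟫`. -/
theorem hasDerivAt_radial_theta (hw : ContDiff ℝ 1 w) (r θ z : ℝ) :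
    HasDerivAt (fun θ' => ⟪w (cylPt r θ' z), eR θ'⟫_ℝ)
      (⟪w (cylPt r θ z), eT θ⟫_ℝ + ⟪fderiv ℝ w (cylPt r θ z) (r • eT θ), eR θ⟫_ℝ) θ := by
  have h1 : HasDerivAt (fun θ' => w (cylPt r θ' z)) (fderiv ℝ w (cylPt r θ z) (r • eT θ)) θ :=
    ((hw.differentiable one_ne_zero) _).hasFDerivAt.comp_hasDerivAt θ (hasDerivAt_cylPt_theta r θ z)
  exact h1.inner ℝ (hasDerivAt_eR θ)

/-- The KEY POINTWISE IDENTITY (Stokes in cylindrical components): with `L = Dw(cylPt r θ z)`,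
`⟪L e_r, e_θ⟫ r + ⟪w, e_θ⟫ = ⟪curl w, e₃⟫ r + (⟪w, e_θ⟫ + ⟪L (r e_θ), e_r⟫)`, i.e.
`∂ᵣ(r w_θ) = r ω₃ + ∂_θ w_r`, because the antisymmetric part of `L` is rotation invariant:
`⟪L e_r, e_θ⟫ − ⟪L e_θ, e_r⟫ = ⟪L e₀, e₁⟫ − ⟪L e₁, e₀⟫ = ω₃`. -/
theorem key_identity (r θ z : ℝ) :
    ⟪fderiv ℝ w (cylPt r θ z) (eR θ), eT θ⟫_ℝ * r + ⟪w (cylPt r θ z), eT θ⟫_ℝ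
      = ⟪curl w (cylPt r θ z), e3⟫_ℝ * r
        + (⟪w (cylPt r θ z), eT θ⟫_ℝ + ⟪fderiv ℝ w (cylPt r θ z) (r • eT θ), eR θ⟫_ℝ) := by
  set L := fderiv ℝ w (cylPt r θ z) with hL
  rw [inner_e3, curl_apply_two, ← hL, eR_eq, eT_eq]
  simp only [map_add, map_smul, map_neg, smul_add, inner_add_left, inner_add_right, inner_smul_left,
    inner_smul_right, inner_neg_left, inner_neg_right, smul_neg, neg_smul,
    EuclideanSpace.inner_single_right, RCLike.conj_to_real, map_smul]
  have h := Real.sin_sq_add_cos_sq θ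
  set c := Real.cos θ
  set σ := Real.sin θ
  set a00 := L (EuclideanSpace.single (0 : Fin 3) (1 : ℝ)) 0
  set a01 := L (EuclideanSpace.single (0 : Fin 3) (1 : ℝ)) 1
  set a10 := L (EuclideanSpace.single (1 : Fin 3) (1 : ℝ)) 0
  set a11 := L (EuclideanSpace.single (1 : Fin 3) (1 : ℝ)) 1
  linear_combination r * (a01 - a10) * h

/-! ### The `θ`-derivative integrates to zero over the period -/

/-- `θ ↦ ⟪w(cylPt r θ z), e_θ⟫ + ⟪Dw(cylPt r θ z)(r e_θ), e_r⟫` is continuous for `C¹` `w`. -/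
theorem continuous_radial_theta_deriv (hw : ContDiff ℝ 1 w) (r z : ℝ) :
    Continuous fun θ => ⟪w (cylPt r θ z), eT θ⟫_ℝ + ⟪fderiv ℝ w (cylPt r θ z) (r • eT θ), eR θ⟫_ℝ := by
  have hp : Continuous fun θ => cylPt r θ z :=
    (contDiff_cylPt z (n := 0)).continuous.comp (continuous_id.prodMk continuous_const)
  have h1 : Continuous fun θ => w (cylPt r θ z) := hw.continuous.comp hp
  have h2 : Continuous fun θ => fderiv ℝ w (cylPt r θ z) := (hw.continuous_fderiv one_ne_zero).comp hp
  exact (h1.inner continuous_eT).add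
    ((h2.clm_apply (continuous_eT.const_smul r)).inner continuous_eR)

/-- `∫₀^{2π} ∂_θ ⟪w(cylPt r θ z), e_r(θ)⟫ dθ = 0` (periodicity). -/
theorem integral_theta_deriv_eq_zero (hw : ContDiff ℝ 1 w) (r z : ℝ) :
    ∫ θ in (0 : ℝ)..(2 * Real.pi),
      (⟪w (cylPt r θ z), eT θ⟫_ℝ + ⟪fderiv ℝ w (cylPt r θ z) (r • eT θ), eR θ⟫_ℝ) = 0 := by
  rw [integral_eq_sub_of_hasDerivAt (fun θ _ => hasDerivAt_radial_theta hw r θ z)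
    ((continuous_radial_theta_deriv hw r z).intervalIntegrable _ _)]
  rw [cylPt_two_pi, eR_two_pi, sub_self]

/-! ### Stokes on circles -/

/-- The integrand `(θ, r') ↦ ⟪w(cylPt r' θ z), e_θ(θ)⟫ r'` is `C¹` jointly. -/
theorem contDiff_integrand (hw : ContDiff ℝ 1 w) (z : ℝ) :
    ContDiff ℝ 1 fun q : ℝ × ℝ => ⟪w (cylPt q.2 q.1 z), eT q.1⟫_ℝ * q.2 := by
  have h1 : ContDiff ℝ 1 fun q : ℝ × ℝ => w (cylPt q.2 q.1 z) := hw.comp (contDiff_cylPt z)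
  have h2 : ContDiff ℝ 1 fun q : ℝ × ℝ => eT q.1 := contDiff_eT.comp contDiff_fst
  exact (h1.inner ℝ h2).mul contDiff_snd

/-- The partial derivative of the integrand in `r'` is `⟪Dw e_r, e_θ⟫ r + ⟪w, e_θ⟫`. -/
theorem fderiv_integrand_apply (hw : ContDiff ℝ 1 w) (z θ r : ℝ) :
    fderiv ℝ (fun q : ℝ × ℝ => ⟪w (cylPt q.2 q.1 z), eT q.1⟫_ℝ * q.2) (θ, r) ((0 : ℝ), (1 : ℝ))
      = ⟪fderiv ℝ w (cylPt r θ z) (eR θ), eT θ⟫_ℝ * r + ⟪w (cylPt r θ z), eT θ⟫_ℝ := by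
  have hH := contDiff_integrand hw z
  have h1 : HasDerivAt (fun r' : ℝ => (fun q : ℝ × ℝ => ⟪w (cylPt q.2 q.1 z), eT q.1⟫_ℝ * q.2) (θ, r'))
      (fderiv ℝ (fun q : ℝ × ℝ => ⟪w (cylPt q.2 q.1 z), eT q.1⟫_ℝ * q.2) (θ, r) ((0 : ℝ), (1 : ℝ))) r := by
    have hc : HasDerivAt (fun r' : ℝ => ((θ, r') : ℝ × ℝ)) ((0 : ℝ), (1 : ℝ)) r :=
      (hasDerivAt_const r θ).prodMk (hasDerivAt_id r)
    exact ((hH.differentiable one_ne_zero) (θ, r)).hasFDerivAt.comp_hasDerivAt r hc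
  exact h1.unique (hasDerivAt_integrand_r hw r θ z)

/-- **Stokes on circles** for a `C¹` field: `d/dr ∫₀^{2π} ⟪w(cylPt r θ z), e_θ⟫ r dθ = ∫₀^{2π} ⟪curl w (cylPt r θ z), e₃⟫ r dθ`. -/
theorem hasDerivAt_circleIntegral (hw : ContDiff ℝ 1 w) (r z : ℝ) :
    HasDerivAt (fun r' => ∫ θ in (0 : ℝ)..(2 * Real.pi), ⟪w (cylPt r' θ z), eT θ⟫_ℝ * r')
      (∫ θ in (0 : ℝ)..(2 * Real.pi), ⟪curl w (cylPt r θ z), e3⟫_ℝ * r) r := by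
  have hH := contDiff_integrand hw z
  -- one derivative under the integral sign
  have hF : HasDerivAt (fun r' => ∫ θ in (0 : ℝ)..(2 * Real.pi), ⟪w (cylPt r' θ z), eT θ⟫_ℝ * r')
      (∫ θ in (0 : ℝ)..(2 * Real.pi),
        fderiv ℝ (fun q : ℝ × ℝ => ⟪w (cylPt q.2 q.1 z), eT q.1⟫_ℝ * q.2) (θ, r) ((0 : ℝ), (1 : ℝ))) r := by
    have hd := (hasFDerivAt_parametric_intervalIntegral hH one_ne_zero 0 (2 * Real.pi) r).hasDerivAt
    rw [← fderiv_parametric_intervalIntegral_apply hH one_ne_zero 0 (2 * Real.pi) r 1,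
      (hasFDerivAt_parametric_intervalIntegral hH one_ne_zero 0 (2 * Real.pi) r).fderiv]
    exact hd
  -- the derivative of the integrand, pointwise: `r ω₃ + ∂_θ w_r`
  have hpt : ∀ θ : ℝ,
      fderiv ℝ (fun q : ℝ × ℝ => ⟪w (cylPt q.2 q.1 z), eT q.1⟫_ℝ * q.2) (θ, r) ((0 : ℝ), (1 : ℝ))
        = ⟪curl w (cylPt r θ z), e3⟫_ℝ * r
          + (⟪w (cylPt r θ z), eT θ⟫_ℝ + ⟪fderiv ℝ w (cylPt r θ z) (r • eT θ), eR θ⟫_ℝ) := fun θ => by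
    rw [fderiv_integrand_apply hw z θ r, key_identity]
  have hp : Continuous fun θ => cylPt r θ z :=
    (contDiff_cylPt z (n := 0)).continuous.comp (continuous_id.prodMk continuous_const)
  have hcurl : Continuous fun θ => ⟪curl w (cylPt r θ z), e3⟫_ℝ * r :=
    (((continuous_curl hw).comp hp).inner continuous_const).mul continuous_const
  rw [intervalIntegral.integral_congr (fun θ _ => hpt θ),
    intervalIntegral.integral_add (hcurl.intervalIntegrable _ _)
      ((continuous_radial_theta_deriv hw r z).intervalIntegrable _ _),
    integral_theta_deriv_eq_zero hw r z, add_zero] at hF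
  exact hF

/-- `deriv` form of `hasDerivAt_circleIntegral`. -/
theorem deriv_circleIntegral (hw : ContDiff ℝ 1 w) (r z : ℝ) :
    deriv (fun r' => ∫ θ in (0 : ℝ)..(2 * Real.pi), ⟪w (cylPt r' θ z), eT θ⟫_ℝ * r') r
      = ∫ θ in (0 : ℝ)..(2 * Real.pi), ⟪curl w (cylPt r θ z), e3⟫_ℝ * r :=
  (hasDerivAt_circleIntegral hw r z).deriv

/-! ### In the vocabulary of the crux: `∂ᵣ Γ = ∮ ω₃ dl` -/

/-- **`∂ᵣΓ = ∮ω₃ dl`** (LRT arXiv:2501.08976 §4, the Stokes relation behind eq. Gamma-30): for a time-dependent field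
`v` whose slice `v s` is `C¹`, the axis circulation `circ v · z s` has derivative `vortCirc v r z s` at every `r`. -/
theorem hasDerivAt_circ (v : ℝ → EuclideanSpace ℝ (Fin 3) → EuclideanSpace ℝ (Fin 3)) {s : ℝ}
    (hv : ContDiff ℝ 1 (v s)) (r z : ℝ) :
    HasDerivAt (fun r' => circ v r' z s) (vortCirc v r z s) r := by
  unfold circ vortCirc
  exact hasDerivAt_circleIntegral hv r z

/-- `deriv (fun r' => circ v r' z s) r = vortCirc v r z s` for a `C¹` slice (first conjunct of
`CircleSwirlEquation`, for smooth slices). -/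
theorem deriv_circ_eq_vortCirc (v : ℝ → EuclideanSpace ℝ (Fin 3) → EuclideanSpace ℝ (Fin 3)) {s : ℝ}
    (hv : ContDiff ℝ 1 (v s)) (r z : ℝ) :
    deriv (fun r' => circ v r' z s) r = vortCirc v r z s :=
  (hasDerivAt_circ v hv r z).deriv

/-- `r ↦ circ v r z s` is differentiable for a `C¹` slice. -/
theorem differentiable_circ (v : ℝ → EuclideanSpace ℝ (Fin 3) → EuclideanSpace ℝ (Fin 3)) {s : ℝ}
    (hv : ContDiff ℝ 1 (v s)) (z : ℝ) :
    Differentiable ℝ fun r' => circ v r' z s :=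
  fun r => (hasDerivAt_circ v hv r z).differentiableAt

end Summit.NavierStokesRegularity.NavierStokesRegularity.Theorems.AveragedConeLiouville.CircleStokes

end
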